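import Summits.CriticalPhenomena.Ising3DConformalLimit.Theorems.PerfectScreeningCoulombImpliesNontrivialEssentialityCriterion
import HarnessLib

/-!
# Crux `CoulombImpliesNontrivial` (stmt-CriticalPhenomena-13885, route PerfectScreening r3), line
# `merging-is-expected-screening`: registered stub `stub_essentialityIdentity`
# (the depletion identity: connection mass of the nested switching lemma = depleted two-point function)

In the free box `Λ_L ⊂ ℤ³` at `β_c(3)`, for `c, e ∈ Λ_L` outside a finite set of sites `C`: write
`T = boxSources 3 L C`, `G₁ = offGraph Λ T` (the free box graph with every bond meeting `C` removed),
`Z_{G₁}[A] = ecurrentSumIn G₁ K A`, `Z[A] = ecurrentSum K A` (`K ≡ β_c(3)`), and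
`CONN = ∑_{(n₁,n₂)} 𝟙[n₁ ⊆ E(G₁), ∂n₁ = ∅] w(n₁) 𝟙[∂n₂ = {c}∆{e}] w(n₂) 𝟙[c ↔ e through (n₁+n₂)|_{E(G₁)}]`
(the connection read on the lifted trace `liftBonds 3 L ((n₁+n₂).tracedIn G₁)`). Then
`⟨σ_cσ_e⟩_{Λ_L∖C} · Z_{G₁}[∅] · Z[ce] = ⟨σ_cσ_e⟩_{Λ_L} · CONN` (in `ℝ`, after `toReal`).

Proof. The nested switching lemma (Aizenman–Duminil-Copin–Sidoravicius 2015, Lemma 2.2; tree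
`Current.etsum_switching_univ` with `A = ∅`, `B = {c}∆{e}`, `F = 1`) gives `CONN = Z_{G₁}[ce] · Z[∅]`
exactly (after switching, the first current has sources `{c}∆{e}` inside `E(G₁)` and so connects `c`
to `e` automatically, `Current.add_mem_connIn_of_sources_eq`). The box dictionary of
`…GaussianLimitNotScreenedDepletionBound` (`toReal_offRatio_eq_defectG`, `boxG_eq_toReal_div`)
reads `⟨σ_cσ_e⟩_{Λ_L∖C} = Z_{G₁}[ce]/Z_{G₁}[∅]` and `⟨σ_cσ_e⟩_{Λ_L} = Z[ce]/Z[∅]`, and both sides equal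
`Z_{G₁}[ce] · Z[ce]` after clearing the denominators `Z_{G₁}[∅], Z[∅] > 0`. Everything is proved;
nothing is defined or cited as a fact. [AizenmanDuminilCopinSidoraviciusCMP2015, Lemma 2.2]
-/

noncomputable section

namespace Summit.CriticalPhenomena.Ising3DConformalLimit.Cruxes.CoulombImpliesNontrivial.MergingIsExpectedScreening

open Filter Topology Set MeasureTheory Finset
open Literature.Probability.LatticeModels Literature.Probability.Percolation
open Summit.CriticalPhenomena.Ising3DConformalLimit.Cruxes.IsingEuclidUpgradeR4NonGaussian.FreeCovarianceDeltaDichotomy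
  (lat boxG)
open Summit.CriticalPhenomena.Ising3DConformalLimit.Cruxes.GaussianLimitNotScreened.KaramataAmplitudeBlindMerging
  (IsSpreadDefect defectG)
open scoped symmDiff
open scoped ENNReal
open Summit.CriticalPhenomena.Ising3DConformalLimit.Cruxes.GaussianLimitNotScreened.KaramataAmplitudeBlindMerging
  (toReal_offRatio_eq_defectG boxG_eq_toReal_div)

/-- The connection event read on the lifted restricted trace is the tree's `Current.connIn`:
`𝟙[liftBonds ((n₁+n₂)|_{E(G₁)}) ∈ {c ↔ e}] = 𝟙[(n₁+n₂) ∈ connIn G₁ c e]`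
(`liftBonds_mem_openConn_iff`). [folklore] -/
theorem indicator_liftBonds_mem_openConn (L : ℕ) (G₁ : SimpleGraph (BoxVertex 3 L))
    [DecidableRel G₁.Adj] (c₀ e₀ : BoxVertex 3 L)
    (p : Current (freeBoxGraph 3 L) × Current (freeBoxGraph 3 L)) :
    {q : Current (freeBoxGraph 3 L) × Current (freeBoxGraph 3 L) |
        liftBonds 3 L ((q.1 + q.2).tracedIn G₁) ∈ openConn (c₀ : Site 3) (e₀ : Site 3)}.indicator
      (1 : Current (freeBoxGraph 3 L) × Current (freeBoxGraph 3 L) → ℝ≥0∞) p =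
      (Current.connIn G₁ c₀ e₀).indicator 1 (p.1 + p.2) := by
  have hiff : p ∈ {q : Current (freeBoxGraph 3 L) × Current (freeBoxGraph 3 L) |
      liftBonds 3 L ((q.1 + q.2).tracedIn G₁) ∈ openConn (c₀ : Site 3) (e₀ : Site 3)} ↔
      p.1 + p.2 ∈ Current.connIn G₁ c₀ e₀ := by
    rw [Set.mem_setOf_eq, liftBonds_mem_openConn_iff]
    exact Iff.rfl
  by_cases h : p.1 + p.2 ∈ Current.connIn G₁ c₀ e₀
  · rw [Set.indicator_of_mem h, Set.indicator_of_mem (hiff.2 h), Pi.one_apply, Pi.one_apply]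
  · rw [Set.indicator_of_notMem h, Set.indicator_of_notMem fun h' => h (hiff.1 h')]

/-- **The connection mass of the nested switching lemma** (ADS15 Lemma 2.2 with the sourceless current
on the subgraph `G₁` and the `{z}∆{t}`-sourced one on `G`, `F = 1`):
`∑ 𝟙[n₁ ⊆ E(G₁), ∂n₁ = ∅] 𝟙[∂n₂ = {z}∆{t}] w w 𝟙[z ↔ t in E(G₁) through n₁+n₂] = Z_{G₁}[{z}∆{t}] · Z[∅]`
(after switching the first current has sources `{z}∆{t}` inside `E(G₁)`, hence connects `z` to `t`).
[cite: AizenmanDuminilCopinSidoraviciusCMP2015, Lemma 2.2] -/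
theorem tsum_isSupp_empty_pair_connIn_eq {V : Type*} [Fintype V] [DecidableEq V]
    {G : SimpleGraph V} [DecidableRel G.Adj] (G₁ : SimpleGraph V) [DecidableRel G₁.Adj]
    {K : G.edgeFinset → ℝ} (hK : ∀ e, 0 ≤ K e) (z t : V) :
    ∑' p : Current G × Current G,
        (if Current.IsSupp G₁ p.1 ∧ p.1.sources = ∅ then p.1.eweight K else 0) *
          (if p.2.sources = {z} ∆ {t} then p.2.eweight K else 0) *
          (Current.connIn G₁ z t).indicator 1 (p.1 + p.2) =
      ecurrentSumIn G₁ K ({z} ∆ {t}) * ecurrentSum K ∅ := by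
  have h := Current.etsum_switching_univ G₁ hK ∅ ({z} ∆ {t}) z t (fun _ => 1)
  simp only [one_mul] at h
  rw [h, Current.ecurrentSumIn_mul_ecurrentSum]
  refine tsum_congr fun p => ?_
  rw [Current.empty_symmDiff, symmDiff_self, Finset.bot_eq_empty]
  by_cases h1 : Current.IsSupp G₁ p.1 ∧ p.1.sources = {z} ∆ {t}
  · rw [if_pos h1, Set.indicator_of_mem (Current.add_mem_connIn_of_sources_eq G₁ h1.1 h1.2 p.2),
      Pi.one_apply, mul_one]
  · simp only [if_neg h1, zero_mul]

/-- **The depletion identity, box-vertex form** (nested switching lemma, ADS15 Lemma 2.2, with the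
sourceless current on the depleted graph `G₁ = offGraph Λ_L T`, `T = boxSources 3 L C`, and the sourced
one on `Λ_L`): `⟨σ_cσ_e⟩_{Λ_L∖C} · (Z_{G₁}[∅] Z[ce]) = ⟨σ_cσ_e⟩_{Λ_L} · CONN`,
`CONN = ∑ 𝟙[n₁ ⊆ E(G₁), ∂n₁ = ∅] 𝟙[∂n₂ = {c}∆{e}] w w 𝟙[c ↔ e in E(G₁)]`. Proof: `CONN = Z_{G₁}[ce] Z[∅]`
(`tsum_isSupp_empty_pair_connIn_eq`), then the box dictionary and clearing the denominators
`Z_{G₁}[∅], Z[∅] > 0`. [cite: AizenmanDuminilCopinSidoraviciusCMP2015, Lemma 2.2] -/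
theorem defectG_mul_eq_boxG_mul_connection (L : ℕ) (K : (freeBoxGraph 3 L).edgeFinset → ℝ)
    (hKβ : K = fun _ => criticalBeta 3) (C : Finset (Site 3)) (c₀ e₀ : BoxVertex 3 L)
    (hc : (c₀ : Site 3) ∈ box 3 L) (he : (e₀ : Site 3) ∈ box 3 L) (hcC : (c₀ : Site 3) ∉ C)
    (heC : (e₀ : Site 3) ∉ C) :
    defectG L C c₀ e₀ *
        (ecurrentSumIn (offGraph (freeBoxGraph 3 L) (boxSources 3 L C)) K ∅ *
          ecurrentSum K ({c₀} ∆ {e₀})).toReal =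
      boxG L c₀ e₀ *
        (∑' p : Current (freeBoxGraph 3 L) × Current (freeBoxGraph 3 L),
          (if Current.IsSupp (offGraph (freeBoxGraph 3 L) (boxSources 3 L C)) p.1 ∧ p.1.sources = ∅
            then p.1.eweight K else 0) *
          (if p.2.sources = ({c₀} : Finset (BoxVertex 3 L)) ∆ {e₀} then p.2.eweight K else 0) *
          {q : Current (freeBoxGraph 3 L) × Current (freeBoxGraph 3 L) |
              liftBonds 3 L ((q.1 + q.2).tracedIn (offGraph (freeBoxGraph 3 L) (boxSources 3 L C))) ∈
                openConn (c₀ : Site 3) (e₀ : Site 3)}.indicator 1 p).toReal := by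
  have hβ : 0 ≤ criticalBeta 3 := criticalBeta_nonneg 3
  have hK : ∀ e', 0 ≤ K e' := fun _ => by rw [hKβ]; exact hβ
  have hcT : c₀ ∉ boxSources 3 L C := fun h => hcC (mem_boxSources_iff.1 h)
  have heT : e₀ ∉ boxSources 3 L C := fun h => heC (mem_boxSources_iff.1 h)
  -- the connection mass is `Z_{G₁}[ce] Z[∅]`
  have hconn : (∑' p : Current (freeBoxGraph 3 L) × Current (freeBoxGraph 3 L),
      (if Current.IsSupp (offGraph (freeBoxGraph 3 L) (boxSources 3 L C)) p.1 ∧ p.1.sources = ∅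
        then p.1.eweight K else 0) *
      (if p.2.sources = ({c₀} : Finset (BoxVertex 3 L)) ∆ {e₀} then p.2.eweight K else 0) *
      {q : Current (freeBoxGraph 3 L) × Current (freeBoxGraph 3 L) |
          liftBonds 3 L ((q.1 + q.2).tracedIn (offGraph (freeBoxGraph 3 L) (boxSources 3 L C))) ∈
            openConn (c₀ : Site 3) (e₀ : Site 3)}.indicator 1 p) =
      ecurrentSumIn (offGraph (freeBoxGraph 3 L) (boxSources 3 L C)) K ({c₀} ∆ {e₀}) *
        ecurrentSum K ∅ := by
    rw [← tsum_isSupp_empty_pair_connIn_eq _ hK]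
    exact tsum_congr fun p => by rw [indicator_liftBonds_mem_openConn]
  rw [hconn]
  -- finiteness and nonvanishing
  have h1top : ecurrentSumIn (offGraph (freeBoxGraph 3 L) (boxSources 3 L C)) K ∅ ≠ ∞ :=
    ecurrentSumIn_ne_top _ hK _
  have hZtop : ∀ S, ecurrentSum K S ≠ ∞ := fun S => ecurrentSum_ne_top hK S
  have hb : 0 < (ecurrentSumIn (offGraph (freeBoxGraph 3 L) (boxSources 3 L C)) K ∅).toReal :=
    ENNReal.toReal_pos (lt_of_lt_of_le zero_lt_one (one_le_ecurrentSumIn_empty _ K)).ne' h1top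
  have hz0 : 0 < (ecurrentSum K ∅).toReal :=
    ENNReal.toReal_pos (ecurrentSum_empty_ne_zero K) (hZtop _)
  -- the box dictionary
  rw [← defectG_map_boxSources L C, ← toReal_offRatio_eq_defectG L K hKβ _ c₀ e₀ hc he hcT heT,
    boxG_eq_toReal_div L K hKβ c₀ e₀ hc he, Current.offRatio, ENNReal.toReal_div,
    ENNReal.toReal_mul, ENNReal.toReal_mul]
  field_simp

/-- **Registered stub `stub_essentialityIdentity` — THE DEPLETION IDENTITY** (line
`merging-is-expected-screening` of crux stmt-CriticalPhenomena-13885; nested switching lemma of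
Aizenman–Duminil-Copin–Sidoravicius 2015, Lemma 2.2, free box `Λ_L ⊂ ℤ³` at `β_c(3)`): for
`c, e ∈ Λ_L` outside `C`, with the connection mass
`CONN = ∑ 𝟙[n₁ ⊆ E(Λ_L∖C), ∂n₁ = ∅] w(n₁) 𝟙[∂n₂ = {c}∆{e}] w(n₂) 𝟙[c ↔ e through (n₁+n₂)|_{E(Λ_L∖C)}]`,
`⟨σ_cσ_e⟩_{Λ_L∖C} · Z_{Λ_L∖C}[∅] · Z_{Λ_L}[ce] = ⟨σ_cσ_e⟩_{Λ_L} · CONN`, i.e.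
`⟨σ_cσ_e⟩_{Λ_L∖C} = ⟨σ_cσ_e⟩_{Λ_L} · (P^{∅}_{Λ_L∖C} ⊗ P^{ce}_{Λ_L})[c ↔ e in (n₁+n₂)|_{E(Λ_L∖C)}]`.
Proof: `defectG_mul_eq_boxG_mul_connection` at the box vertices of `c, e` (`boxSources_pair`).
[cite: AizenmanDuminilCopinSidoraviciusCMP2015, Lemma 2.2] -/
theorem stub_essentialityIdentity :
    ∀ (L : ℕ) (C : Finset (Site 3)) (c e : Site 3), c ∈ box 3 L → e ∈ box 3 L → c ∉ C → e ∉ C →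
      defectG L C c e *
          (ecurrentSumIn (offGraph (freeBoxGraph 3 L) (boxSources 3 L C))
              (fun _ : (freeBoxGraph 3 L).edgeFinset => criticalBeta 3) ∅ *
            ecurrentSum (fun _ : (freeBoxGraph 3 L).edgeFinset => criticalBeta 3)
              (boxSources 3 L ({c} ∆ {e}))).toReal =
        boxG L c e *
          (∑' p : Current (freeBoxGraph 3 L) × Current (freeBoxGraph 3 L),
            (if Current.IsSupp (offGraph (freeBoxGraph 3 L) (boxSources 3 L C)) p.1 ∧ p.1.sources = ∅
              then p.1.eweight (fun _ : (freeBoxGraph 3 L).edgeFinset => criticalBeta 3) else 0) *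
            (if p.2.sources = boxSources 3 L ({c} ∆ {e})
              then p.2.eweight (fun _ : (freeBoxGraph 3 L).edgeFinset => criticalBeta 3) else 0) *
            {q : Current (freeBoxGraph 3 L) × Current (freeBoxGraph 3 L) |
                liftBonds 3 L ((q.1 + q.2).tracedIn (offGraph (freeBoxGraph 3 L) (boxSources 3 L C))) ∈
                  openConn c e}.indicator 1 p).toReal := by
  intro L C c e hc he hcC heC
  -- box vertices of `c, e`
  have hl : ∀ x ∈ box 3 L, ∃ x' : BoxVertex 3 L, (x' : Site 3) = x := fun x hx =>
    ⟨⟨x, box_subset_box_succ 3 L hx⟩, rfl⟩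
  obtain ⟨⟨c₀, rfl⟩, ⟨e₀, rfl⟩⟩ := And.intro (hl c hc) (hl e he)
  rw [boxSources_pair]
  exact defectG_mul_eq_boxG_mul_connection L _ rfl C c₀ e₀ hc he hcC heC

end Summit.CriticalPhenomena.Ising3DConformalLimit.Cruxes.CoulombImpliesNontrivial.MergingIsExpectedScreening

end
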